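import Summits.SmoothPoincare4.SmoothPoincare4.Theorems.CylinderEntropyImmortalAreaToFloorCounting
import HarnessLib

/-!
# Route `CylinderEntropy`, crux `CylinderRungTwo` (stmt-SmoothPoincare4-7631), line `killing-flux`:
# COUNTING IN DEGREE ZERO — a set with injective shadow is dominated by its complement when every
# generic vertical line carries as many upward as downward crossings

Registered helper `helper_parityCounting` (lead c7, wave 3).  The degree-`0` twin of the counting lemma of item
`ImmortalAreaToFloor` (`ofReal_mul_riemannianMeasure_le_of_injOn_shadow`, `…ImmortalAreaToFloorCounting.lean`):
for a smooth embedded cross-section `ι : M⁴ → N = S⁴ × ℝ ⊂ ℝ⁶` with continuous unit normal `ν` tangent to `N`,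
suppose that for `μH⁴`-a.e. `p ∈ S⁴` the fibre of the shadow `σ = truncL ∘ ι` over `p` is a finite set of regular
crossings (`ν₅ ≠ 0`) with AS MANY UPWARD AS DOWNWARD ones (CROSSING PARITY ZERO — landed for non-separating
cross-sections with a pocket, `helper_crossingParityOfPocket`, p144812).  Then for every measurable `P ⊆ M` on which
`σ` is injective and `|ν₅| ≥ s₀ > 0`:
`s₀ · μ(P) ≤ μ(M ∖ P)` for the induced area measure `μ = μ_{ι^*δ}`.
Proof: by the landed multiplicity area formula (`lintegral_abs_nu5_eq_lintegral_encard`, Federer 3.2.3)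
`s₀ μ(P) ≤ ∫_P |ν₅| = ∫ #(σ⁻¹{p} ∩ P) d𝓗⁴(p)`; for a.e. `p`, if the fibre meets `P` (in exactly one point `x`, by
injectivity) then, the fibre having an even number `2 #F₊ ≥ 2` of points, some OTHER crossing `x' ≠ x` lies over `p`,
and `x' ∉ P`; so `#(σ⁻¹{p} ∩ P) ≤ #(σ⁻¹{p} ∩ (Pᶜ ∩ {ν₅ ≠ 0}))` a.e., whose integral is `∫_{Pᶜ ∩ {ν₅ ≠ 0}} |ν₅| ≤ μ(Pᶜ)`.
In the proof that NULL SURVIVORS DIE this replaces "multiplicity `≤ 1` ⇒ area `≤ vol`": the good set of a late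
slice of a null survivor has injective shadow, hence is dominated by the (small) bad set, contradicting the
parabolic area floor.

References: H. Federer, *Geometric Measure Theory* (1969), 3.2.3; M. W. Hirsch, *Differential Topology* (1976),
Ch. 5 §1 (degree as a signed count of preimages).
-/

-- the prescribed namespace `Summit.SmoothPoincare4.SmoothPoincare4.…` repeats `SmoothPoincare4`
set_option linter.dupNamespace false

noncomputable section

open MeasureTheory Set Function Filter Module
open scoped Manifold ContDiff ENNReal Topology RealInnerProductSpace NNReal

namespace Summit.SmoothPoincare4.SmoothPoincare4.Cruxes.CylinderRungTwo.KillingFlux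

open Literature.Geometry.Riemannian
open Literature.Geometry.Lorentzian Literature.Geometry.Lorentzian.PseudoRiemannianMetric
open Literature.Geometry.Riemannian.SphericalCylinderEntropy (truncL truncL_apply)
open Summit.SmoothPoincare4.SmoothPoincare4.Theorems.CylinderRungTwo.KillingFlux
  (lintegral_abs_nu5_eq_lintegral_encard norm_nu)

variable {M : Type} [TopologicalSpace M] [ChartedSpace (EuclideanSpace ℝ (Fin 4)) M] [IsManifold (𝓡 4) ∞ M]
  [CompactSpace M] [MeasurableSpace M] [BorelSpace M] [SecondCountableTopology M] [Nonempty M]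

/-- **Degree-zero counting with the multiplicity area formula** (Euclidean Hausdorff measures).  For a smooth
embedded cross-section `ι : M → N` with continuous unit normal `ν` tangent to `N`, crossing parity zero along
a.e. vertical line, a measurable `P ⊆ M`, `s₀ > 0` with `|ν₅| ≥ s₀` on `P`, and the shadow injective on `P`:
`ofReal s₀ · (ι^*μHE⁴)(P) ≤ (ι^*μHE⁴)(Pᶜ)`. [cite: Federer1969, 3.2.3] -/
theorem ofReal_mul_comap_le_comap_compl_of_parity {ι ν : M → EuclideanSpace ℝ (Fin 6)}
    (hι : Manifold.IsSmoothEmbedding (𝓡 4) (𝓡 6) ∞ ι)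
    (hιN : ∀ x, ∑ i : Fin 5, ι x (Fin.castSucc i) ^ 2 = 1)
    (hνc : Continuous ν) (hνn : (euclideanMetric (EuclideanSpace ℝ (Fin 6))).IsUnitNormal (𝓡 4) ι ν 1)
    (hνt : ∀ x, ∑ i : Fin 5, ν x (Fin.castSucc i) * ι x (Fin.castSucc i) = 0)
    (hpar : ∀ᵐ p ∂(μH[4] : Measure (EuclideanSpace ℝ (Fin 5))),
      p ∈ Metric.sphere (0 : EuclideanSpace ℝ (Fin 5)) 1 →
        ∃ F : Finset M, (∀ x, x ∈ F ↔ truncL (ι x) = p) ∧ (∀ x ∈ F, ν x 5 ≠ 0) ∧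
          (F.filter (fun x => 0 < ν x 5)).card = (F.filter (fun x => ν x 5 < 0)).card)
    {P : Set M} (hPm : MeasurableSet P) {s₀ : ℝ} (hs₀ : 0 < s₀) (hP : ∀ x ∈ P, s₀ ≤ |ν x 5|)
    (hinj : InjOn (fun x => truncL (ι x)) P) :
    ENNReal.ofReal s₀ * (Measure.comap ι (μHE[4] : Measure (EuclideanSpace ℝ (Fin 6)))) P ≤
      (Measure.comap ι (μHE[4] : Measure (EuclideanSpace ℝ (Fin 6)))) Pᶜ := by
  classical
  set σ : M → EuclideanSpace ℝ (Fin 5) := fun x => truncL (ι x) with hσ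
  set μE : Measure M := Measure.comap ι (μHE[4] : Measure (EuclideanSpace ℝ (Fin 6))) with hμE
  -- the two pieces `P ⊆ {ν₅ ≠ 0}` and `P' := Pᶜ ∩ {ν₅ ≠ 0}`
  have hP0 : P ⊆ {x | ν x 5 ≠ 0} := by
    intro x hx h0
    have h := hP x hx
    have h0' : ν x 5 = 0 := h0
    rw [h0', abs_zero] at h
    exact absurd h (not_le.2 hs₀)
  have h5c : Continuous fun x => ν x 5 := (EuclideanSpace.proj (5 : Fin 6)).continuous.comp hνc
  have hreg : MeasurableSet {x : M | ν x 5 ≠ 0} := (isClosed_eq h5c continuous_const).measurableSet.compl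
  set P' : Set M := Pᶜ ∩ {x | ν x 5 ≠ 0} with hP'
  have hP'm : MeasurableSet P' := hPm.compl.inter hreg
  have hP'0 : P' ⊆ {x | ν x 5 ≠ 0} := inter_subset_right
  obtain ⟨-, hformula⟩ := lintegral_abs_nu5_eq_lintegral_encard hι hιN hνc hνn hνt hPm hP0
  obtain ⟨-, hformula'⟩ := lintegral_abs_nu5_eq_lintegral_encard hι hιN hνc hνn hνt hP'm hP'0
  -- the shadow lands in the unit sphere
  have hσS : ∀ x, σ x ∈ Metric.sphere (0 : EuclideanSpace ℝ (Fin 5)) 1 := fun x => by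
    rw [mem_sphere_zero_iff_norm, EuclideanSpace.norm_eq, Real.sqrt_eq_one]
    simpa [hσ, truncL_apply, Real.norm_eq_abs, sq_abs] using hιN x
  -- parity, a.e. for `μHE⁴`
  obtain ⟨c, -, hc⟩ : ∃ c : ℝ≥0, c ≠ 0 ∧ (μHE[4] : Measure (EuclideanSpace ℝ (Fin 5))) =
      c • (μH[4] : Measure (EuclideanSpace ℝ (Fin 5))) :=
    ⟨_, Measure.addHaarScalarFactor_volume_hausdorffMeasure_ne_zero 4,
      Measure.euclideanHausdorffMeasure_def (X := EuclideanSpace ℝ (Fin 5)) 4⟩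
  have hparE : ∀ᵐ p ∂(μHE[4] : Measure (EuclideanSpace ℝ (Fin 5))),
      p ∈ Metric.sphere (0 : EuclideanSpace ℝ (Fin 5)) 1 →
        ∃ F : Finset M, (∀ x, x ∈ F ↔ truncL (ι x) = p) ∧ (∀ x ∈ F, ν x 5 ≠ 0) ∧
          (F.filter (fun x => 0 < ν x 5)).card = (F.filter (fun x => ν x 5 < 0)).card := by
    rw [hc]
    exact Measure.ae_smul_measure hpar _
  -- a.e. domination of the multiplicities
  have hmult : ∀ᵐ p ∂(μHE[4] : Measure (EuclideanSpace ℝ (Fin 5))),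
      ((σ ⁻¹' {p} ∩ P).encard : ℝ≥0∞) ≤ ((σ ⁻¹' {p} ∩ P').encard : ℝ≥0∞) := by
    filter_upwards [hparE] with p hp
    by_cases hne : (σ ⁻¹' {p} ∩ P).Nonempty
    · obtain ⟨x, hxp, hxP⟩ := hne
      have hxp' : σ x = p := hxp
      obtain ⟨F, hFmem, hFreg, hFcard⟩ := hp (hxp' ▸ hσS x)
      -- the fibre meets `P` in exactly `x`
      have h1 : σ ⁻¹' {p} ∩ P = {x} := by
        refine Set.eq_singleton_iff_unique_mem.2 ⟨⟨hxp, hxP⟩, fun y hy => ?_⟩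
        exact hinj hy.2 hxP ((show σ y = p from hy.1).trans hxp'.symm)
      -- the fibre has at least two points: `#F = 2 #F₊` and `x ∈ F`
      have hxF : x ∈ F := (hFmem x).2 hxp'
      have hsplit : (F.filter fun y => 0 < ν y 5).card + (F.filter fun y => ν y 5 < 0).card = F.card := by
        have hneg : (F.filter fun y => ¬ 0 < ν y 5) = F.filter fun y => ν y 5 < 0 :=
          Finset.filter_congr fun y hy => ⟨fun h => lt_of_le_of_ne (not_lt.1 h) (hFreg y hy),
            fun h => not_lt.2 h.le⟩
        rw [← hneg]
        exact Finset.card_filter_add_card_filter_not _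
      have htwo : 2 ≤ F.card := by
        have hpos : 0 < F.card := Finset.card_pos.2 ⟨x, hxF⟩
        omega
      obtain ⟨x', hx'F, hx'ne⟩ : ∃ x' ∈ F, x' ≠ x := by
        by_contra hcon
        push Not at hcon
        have hsub : F ⊆ {x} := fun y hy => Finset.mem_singleton.2 (hcon y hy)
        have := Finset.card_le_card hsub
        rw [Finset.card_singleton] at this
        omega
      have hx'p : σ x' = p := (hFmem x').1 hx'F
      have hx'P : x' ∉ P := fun h => hx'ne (hinj h hxP (hx'p.trans hxp'.symm))
      have hx'mem : x' ∈ σ ⁻¹' {p} ∩ P' := ⟨hx'p, hx'P, hFreg x' hx'F⟩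
      rw [h1, Set.encard_singleton]
      have h2 : (1 : ℕ∞) ≤ (σ ⁻¹' {p} ∩ P').encard :=
        Set.one_le_encard_iff_nonempty.2 ⟨x', hx'mem⟩
      exact_mod_cast ENat.toENNReal_le.2 h2
    · rw [Set.not_nonempty_iff_eq_empty.1 hne, Set.encard_empty]
      simp
  -- `|ν₅| ≤ 1`
  have hle : ∀ x, |ν x 5| ≤ 1 := fun x => by
    have h := PiLp.norm_apply_le (ν x) (5 : Fin 6)
    rw [norm_nu hνn x, Real.norm_eq_abs] at h
    exact h
  -- assemble
  calc ENNReal.ofReal s₀ * μE P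
      = ∫⁻ _ in P, ENNReal.ofReal s₀ ∂μE := (setLIntegral_const P _).symm
    _ ≤ ∫⁻ x in P, ENNReal.ofReal |ν x 5| ∂μE :=
        setLIntegral_mono' hPm fun x hx => ENNReal.ofReal_le_ofReal (hP x hx)
    _ = ∫⁻ p, ((σ ⁻¹' {p} ∩ P).encard : ℝ≥0∞) ∂(μHE[4] : Measure (EuclideanSpace ℝ (Fin 5))) := hformula
    _ ≤ ∫⁻ p, ((σ ⁻¹' {p} ∩ P').encard : ℝ≥0∞) ∂(μHE[4] : Measure (EuclideanSpace ℝ (Fin 5))) :=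
        lintegral_mono_ae hmult
    _ = ∫⁻ x in P', ENNReal.ofReal |ν x 5| ∂μE := hformula'.symm
    _ ≤ ∫⁻ _ in P', 1 ∂μE := by
        refine setLIntegral_mono' hP'm fun x _ => ?_
        rw [← ENNReal.ofReal_one]
        exact ENNReal.ofReal_le_ofReal (hle x)
    _ = μE P' := by rw [setLIntegral_const, one_mul]
    _ ≤ μE Pᶜ := measure_mono inter_subset_left

/-- **Registered helper `helper_parityCounting` of line `killing-flux` (lead c7, wave 3): degree-zero counting in
terms of the induced area measure.**  For a smooth embedded cross-section `ι : M → N` (also a spacelike immersion, so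
that the induced area measure `μ_{ι^*δ}` is available) with continuous unit normal `ν` tangent to `N` and crossing
parity zero along `μH⁴`-a.e. vertical line over `S⁴` (finite regular fibre with `#F₊ = #F₋`), every measurable
`P ⊆ M` with `|ν₅| ≥ s₀ > 0` on `P` and injective shadow satisfies `ofReal s₀ · μ_{ι^*δ}(P) ≤ μ_{ι^*δ}(Pᶜ)`
(`μ_{ι^*δ} = ι^*μHE⁴`, tree `riemannianMeasure_induced_apply`). [cite: Federer1969, 3.2.3] -/
theorem helper_parityCounting : ∀ (M : Type) [TopologicalSpace M] [T2Space M] [SecondCountableTopology M]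
    [ChartedSpace (EuclideanSpace ℝ (Fin 4)) M] [IsManifold (𝓡 4) ∞ M] [CompactSpace M] [MeasurableSpace M]
    [BorelSpace M] [Nonempty M] (ι ν : M → EuclideanSpace ℝ (Fin 6)),
    Manifold.IsSmoothEmbedding (𝓡 4) (𝓡 6) ∞ ι →
    ∀ himm : (euclideanMetric (EuclideanSpace ℝ (Fin 6))).IsSpacelikeImmersion (𝓡 4) ι,
    (∀ x, ∑ i : Fin 5, ι x (Fin.castSucc i) ^ 2 = 1) → Continuous ν →
    (euclideanMetric (EuclideanSpace ℝ (Fin 6))).IsUnitNormal (𝓡 4) ι ν 1 →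
    (∀ x, ∑ i : Fin 5, ν x (Fin.castSucc i) * ι x (Fin.castSucc i) = 0) →
    (∀ᵐ p ∂(μH[4] : Measure (EuclideanSpace ℝ (Fin 5))), p ∈ Metric.sphere (0 : EuclideanSpace ℝ (Fin 5)) 1 →
      ∃ F : Finset M, (∀ x, x ∈ F ↔ truncL (ι x) = p) ∧ (∀ x ∈ F, ν x 5 ≠ 0) ∧
        (F.filter (fun x => 0 < ν x 5)).card = (F.filter (fun x => ν x 5 < 0)).card) →
    ∀ (P : Set M), MeasurableSet P → ∀ s₀ : ℝ, 0 < s₀ → (∀ x ∈ P, s₀ ≤ |ν x 5|) →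
    Set.InjOn (fun x => truncL (ι x)) P →
    ENNReal.ofReal s₀ * riemannianMeasure ((euclideanMetric (EuclideanSpace ℝ (Fin 6))).inducedRiemannianMetric ι
      contMDiff_pullbackBilin_holds himm) P ≤
      riemannianMeasure ((euclideanMetric (EuclideanSpace ℝ (Fin 6))).inducedRiemannianMetric ι
        contMDiff_pullbackBilin_holds himm) Pᶜ := by
  intro M _ _ _ _ _ _ _ _ _ ι ν hι himm hιN hνc hνn hνt hpar P hPm s₀ hs₀ hP hinj
  have hinjι : Injective ι := hι.isEmbedding.injective
  have hme : MeasurableEmbedding ι :=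
    (himm.contMDiff.continuous.isClosedEmbedding hinjι).measurableEmbedding
  have heq : ∀ S : Set M, MeasurableSet S →
      riemannianMeasure ((euclideanMetric (EuclideanSpace ℝ (Fin 6))).inducedRiemannianMetric ι
        contMDiff_pullbackBilin_holds himm) S =
      (Measure.comap ι (μHE[4] : Measure (EuclideanSpace ℝ (Fin 6)))) S := fun S hS => by
    rw [riemannianMeasure_induced_apply himm hinjι hS, hme.comap_apply]
  rw [heq P hPm, heq Pᶜ hPm.compl]
  exact ofReal_mul_comap_le_comap_compl_of_parity hι hιN hνc hνn hνt hpar hPm hs₀ hP hinj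

end Summit.SmoothPoincare4.SmoothPoincare4.Cruxes.CylinderRungTwo.KillingFlux

end
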